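import Mathlib
import Literature.NumberTheory.EllipticCurves.PAdicOneVariableGaussSum
import Literature.NumberTheory.EllipticCurves.ProfiniteGroupDistributionCharacterCells
import Literature.NumberTheory.EllipticCurves.ProfiniteGroupDistributionInduction
import Literature.NumberTheory.EllipticCurves.PAdicMeasureWeightKAction
import Literature.NumberTheory.EllipticCurves.PAdicOneVariableMomentDensity

/-!
# k3-g38 — DECOMPOSITION of the atom (KLF-COSET)₂ (STUB-PLAN v7.0 HARDEST (b), R197a″ (i-a), typing B)
# into sub-stubs with PROVED glue: the RAMIFIED twin of the tree's unramified coset/moment chain at `p = 2`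

Stub: `stub_heegnerIndexLowerAtTwo` (skeleton `f2bd84c0…`, crux `SplitBadTwoLowerHalfOfFacts`, route PrintCf2).
BSD is NOT proved by anything in this file; nothing here touches `Theorems/`.

The atom (critic g37, row 107): de Shalit II.4.8 (21) at `k = 0` + 4.9–4.10 + 5.2 (3) at `p = 2` for the
finite-order `χ` of inertia type `θ` at ONE level `n+1 = e ∈ {2, 3}`.  Typing B = "analyst triple over tree
engines".  The tree has the whole UNRAMIFIED chain at `p = 2` along an abstract tower
(`integral_induce_character_pow_succ_seriesFamily` = II.4.7 (16)–(17), socket = I.3.5 (11)); the RAMIFIED chain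
(Gauss sum × torsion-point values) exists only on `ℤ₂` (`mul_integral_mulChar_invAmice₁_eq_gaussSum_mul`).

THIS FILE (everything `theorem` is proved, `def … : Prop` are the typed sub-stubs):
* §1 (Mathlib) ★ `sum_mulChar_mul_apply_castHom_eq_zero` — PRIMITIVE-FIBRE VANISHING: a character of `ℤ/N` not
  factoring through `ℤ/M` kills every function of `j mod M` (de Shalit p. 61: "the terms with `p ∣ j` disappear …
  because `n` is the exact power of `𝔭` in `𝔣_χ`"; it ALSO kills the `(7′)`-correction `−½·log g([π']·)` of `log̃`);
  the three dyadic inertia types `χ₄, χ₈, χ₈'` of the six keys are instances (`decide`d witnesses `u = 3, 5, 5`);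
  range-indexed form `sum_range_mulChar_mul_eq_zero` matching the tree's `∑ j ∈ range (2^(n+1))`.
* §2 (Mathlib) ★ `gaussSum_inv_eq` — the (19)-normalisation seam `g(χ, ψ⁻¹) = χ(−1)·g(χ, ψ)`
  (de Shalit's `τ(χ) = 2^{-(n+1)}·Σ χ(γ) ζ^{−κ(γ)}` vs the tree's `Σ χ(b) ζ^{b}`).
* §3 (Mathlib) ★ `sum_mulChar_neg_mul_eq_sum_units` — the (22) re-indexing `j ↔ γ` through `κ mod 2^{n+1}`:
  `Σ_j χ(−j) V(j) = χ(−1) Σ_γ χ(e γ) ℓ(γ)` for `V ∘ e = ℓ`; ★ `atom_shape` — the abstract COMPOSITION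
  (two-term `(7′)` structure `V = V₁ − V₂ ∘ cast`, `V₂` dies by §1, `V₁` re-indexes by §3).
* §4 (TREE currency, `p = 2`, abstract tower `(G, 𝒰, κ)` with the cell hypotheses of
  `ProfiniteGroupDistributionCharacterCells`) ★★ `integral_induce_of_mulChar` and ★★★ `ramifiedCosetFormula` —
  **the RAMIFIED COSET FORMULA, PROVED**: for a tower-continuous multiplicative `χ : G → 𝕜` whose restriction to
  `U_0` is `χ₀ ∘ (κ mod 2^{n+1})` with `χ₀` PRIMITIVE,
  `2^{n+1} · ∫_G χ d i(b) = g(χ₀, ζ) · Σ_{c ∈ G/U_0} χ(r_c) · Σ_{j<2^{n+1}} χ₀⁻¹(−j) · P_{r_c⁻¹•b}(ζ^j − 1)`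
  for the LOG-currency family `D_b = comap (D_{P_b}|_{ℤ₂ˣ}) ψ` (links: `GroupDistribution.integral_induce`,
  `integral_comap_restrictUnits_of_character_two`, `integral_restrictUnits_mulChar` (here),
  `mul_integral_mulChar_invAmice₁_eq_gaussSum_mul`).
* §5 ★ `logDerivSeam_holds` — the LOG/DERIVATIVE SEAM IS PROVED: `(x⁻¹·D_{DA})|_{ℤ₂ˣ} = D_A|_{ℤ₂ˣ}` (all
  masses; `density_cast_invAmice₁_μ` + `density_density_μ`; no trace hypothesis), so the tree's derivative-currency
  family and the log-currency family of §4 AGREE once a bounded primitive exists; §5b ★ SEAM-TRANSPORT PROVED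
  (`groupDistribution_integral_congr_μ`, `induce_integral_congr_of_restrictUnits_μ_eq`,
  `induce_integral_derivCurrency_eq_logCurrency`: `induce_μ`/`comap_μ` are level-data formulas, so equal unit-masses
  ⟹ equal induced integrals — the seam is usable INSIDE `induce`, integrand by integrand).  Typed SUB-STUBS left to provers
  (Props): `BoundedPrimitive` (S/M⁻; `∃ A` bounded with `DA = H_b`:
  `A = Ω_p⁻¹·Θ(log̃ g_b ∘ ϑ)`, bounded at `p = 2` because `v₂(2^k/k) ≥ 1`), and the one genuinely new piece
  `RamifiedReading` (M⁻; the torsion-point VALUES `A_b(ζ^j − 1)` are `Θ`-images of `log̃ g_b(ϑ(ζ^j − 1))`, i.e.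
  `log (σ_j b)_n − ½ log(σ_j b')_{n-1}` by `evalAt_cohPt_colemanSeries` + Galois equivariance — stated here in the
  abstract two-term form consumed by `atom_shape`; its Lubin–Tate discharge is the card's Plan C).
-/

namespace Summit.BirchSwinnertonDyer.BirchSwinnertonDyer.Cruxes.SplitBadTwoLowerHalfOfFacts.RamifiedCosetK3G38

open Finset

/-! ### §1. Primitive-fibre vanishing (Mathlib only) -/

section Vanishing

variable {R : Type*} [CommRing R] [IsDomain R] {N M : ℕ} [NeZero N]

/-- ★ **Primitive-fibre vanishing.** If `χ` (a multiplicative character of `ℤ/N`) does not factor through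
`ℤ/M` — witnessed by a unit `u ≡ 1 (mod M)` with `χ u ≠ 1` — then `Σ_{j mod N} χ(j) · f(j mod M) = 0` for EVERY
`f`.  De Shalit II.4.8, proof of (21): the terms with `p ∣ j` vanish; and the `(7′)`-correction of `log̃ g`
(a function of `2j`, i.e. of `j mod 2^n`) vanishes against a primitive `χ` mod `2^{n+1}`. -/
theorem sum_mulChar_mul_apply_castHom_eq_zero (hMN : M ∣ N) (χ : MulChar (ZMod N) R) (u : (ZMod N)ˣ)
    (hu : ZMod.castHom hMN (ZMod M) (u : ZMod N) = 1) (hχu : χ u ≠ 1) (f : ZMod M → R) :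
    ∑ j : ZMod N, χ j * f (ZMod.castHom hMN (ZMod M) j) = 0 := by
  set S := ∑ j : ZMod N, χ j * f (ZMod.castHom hMN (ZMod M) j) with hS
  have h : S = χ u * S := by
    calc S = ∑ j : ZMod N, χ ((u : ZMod N) * j) * f (ZMod.castHom hMN (ZMod M) ((u : ZMod N) * j)) := by
          rw [hS]
          exact (Fintype.sum_equiv u.mulLeft _ _ (fun _ ↦ rfl)).symm
      _ = ∑ j : ZMod N, χ u * (χ j * f (ZMod.castHom hMN (ZMod M) j)) := by
          refine Finset.sum_congr rfl fun j _ ↦ ?_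
          rw [map_mul, map_mul, hu, one_mul, mul_assoc]
      _ = χ u * S := by rw [hS, Finset.mul_sum]
  have h2 : (1 - χ u) * S = 0 := by rw [sub_mul, one_mul, ← h, sub_self]
  rcases mul_eq_zero.mp h2 with h3 | h3
  · exact absurd (sub_eq_zero.mp h3).symm hχu
  · exact h3

/-- Range-indexed sums over `ℕ`-casts are sums over `ℤ/N` (the tree's `∑ j ∈ range (p^(n+1))` convention). -/
theorem sum_range_natCast_eq_sum_zmod {A : Type*} [AddCommMonoid A] (G : ZMod N → A) :
    ∑ j ∈ range N, G (j : ZMod N) = ∑ a : ZMod N, G a := by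
  refine Finset.sum_nbij' (fun j ↦ (j : ZMod N)) (fun a ↦ a.val) (fun _ _ ↦ Finset.mem_univ _)
    (fun a _ ↦ Finset.mem_range.mpr (ZMod.val_lt a)) (fun j hj ↦ ?_) (fun a _ ↦ ?_) (fun _ _ ↦ rfl)
  · exact ZMod.val_natCast_of_lt (Finset.mem_range.mp hj)
  · exact ZMod.natCast_zmod_val a

/-- ★ Range form of primitive-fibre vanishing: `Σ_{j < N} χ(j mod N) · F(j mod M) = 0`. -/
theorem sum_range_mulChar_mul_eq_zero (hMN : M ∣ N) (χ : MulChar (ZMod N) R) (u : (ZMod N)ˣ)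
    (hu : ZMod.castHom hMN (ZMod M) (u : ZMod N) = 1) (hχu : χ u ≠ 1) (F : ZMod M → R) :
    ∑ j ∈ range N, χ (j : ZMod N) * F (j : ZMod M) = 0 := by
  calc ∑ j ∈ range N, χ (j : ZMod N) * F (j : ZMod M)
      = ∑ j ∈ range N, (fun a : ZMod N ↦ χ a * F (ZMod.castHom hMN (ZMod M) a)) (j : ZMod N) :=
        Finset.sum_congr rfl fun j _ ↦ by simp only [map_natCast]
    _ = ∑ a : ZMod N, χ a * F (ZMod.castHom hMN (ZMod M) a) :=
        sum_range_natCast_eq_sum_zmod (fun a : ZMod N ↦ χ a * F (ZMod.castHom hMN (ZMod M) a))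
    _ = 0 := sum_mulChar_mul_apply_castHom_eq_zero hMN χ u hu hχu F

omit [IsDomain R] [NeZero N] in
/-- The inverse character has the same non-factoring witness. -/
theorem inv_apply_ne_one_of_apply_ne_one (χ : MulChar (ZMod N) R) (u : (ZMod N)ˣ) (hχu : χ u ≠ 1) :
    χ⁻¹ u ≠ 1 := by
  intro h
  apply hχu
  have h1 : χ⁻¹ u * χ u = 1 := by
    rw [← MulChar.mul_apply, inv_mul_cancel, MulChar.one_apply_coe]
  rw [h, one_mul] at h1
  exact h1

end Vanishing

/-! ### §1b. The three dyadic inertia types of the six keys are instances (levels `4` and `8`) -/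

section Keys

/-- Level `4` (keys `u ∈ {−1, 3}`, type `χ₄`, `e = 2`): witness `u = 3 ≡ 1 (mod 2)`, `χ₄(3) = −1`. -/
theorem keyWitness_four :
    ZMod.castHom (show (2 : ℕ) ∣ 4 by norm_num) (ZMod 2) ((Units.mkOfMulEqOne (3 : ZMod 4) 3 (by decide) :
      (ZMod 4)ˣ) : ZMod 4) = 1 ∧ ZMod.χ₄ (Units.mkOfMulEqOne (3 : ZMod 4) 3 (by decide)) ≠ 1 := by
  constructor <;> decide

/-- Level `8`, type `χ₈` (keys `u ∈ {2, 6}`·): witness `u = 5 ≡ 1 (mod 4)`, `χ₈(5) = −1`. -/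
theorem keyWitness_eight :
    ZMod.castHom (show (4 : ℕ) ∣ 8 by norm_num) (ZMod 4) ((Units.mkOfMulEqOne (5 : ZMod 8) 5 (by decide) :
      (ZMod 8)ˣ) : ZMod 8) = 1 ∧ ZMod.χ₈ (Units.mkOfMulEqOne (5 : ZMod 8) 5 (by decide)) ≠ 1 := by
  constructor <;> decide

/-- Level `8`, type `χ₈'` (keys `u ∈ {−2, −6}`·): same witness `u = 5`, `χ₈'(5) = −1`. -/
theorem keyWitness_eight' :
    ZMod.castHom (show (4 : ℕ) ∣ 8 by norm_num) (ZMod 4) ((Units.mkOfMulEqOne (5 : ZMod 8) 5 (by decide) :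
      (ZMod 8)ˣ) : ZMod 8) = 1 ∧ ZMod.χ₈' (Units.mkOfMulEqOne (5 : ZMod 8) 5 (by decide)) ≠ 1 := by
  constructor <;> decide

/-- The `(7′)`/`p ∣ j` vanishing AT THE KEY LEVEL `8`, type `χ₈`: any function of `j mod 4` dies. -/
theorem vanishing_eight (F : ZMod 4 → ℤ) :
    ∑ j ∈ range 8, ZMod.χ₈ (j : ZMod 8) * F (j : ZMod 4) = 0 :=
  sum_range_mulChar_mul_eq_zero (show (4 : ℕ) ∣ 8 by norm_num) ZMod.χ₈ _ keyWitness_eight.1 keyWitness_eight.2 F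

/-- … and at level `4`, type `χ₄`: any function of `j mod 2` dies. -/
theorem vanishing_four (F : ZMod 2 → ℤ) :
    ∑ j ∈ range 4, ZMod.χ₄ (j : ZMod 4) * F (j : ZMod 2) = 0 :=
  sum_range_mulChar_mul_eq_zero (show (2 : ℕ) ∣ 4 by norm_num) ZMod.χ₄ _ keyWitness_four.1 keyWitness_four.2 F

end Keys

/-! ### §2. The (19)-normalisation seam for the Gauss sum (Mathlib only) -/

section GaussSeam

variable {R R' : Type*} [CommRing R] [Fintype R] [CommRing R']

/-- ★ `g(χ, ψ⁻¹) = χ(−1) · g(χ, ψ)`: de Shalit's `τ(χ) = 2^{-(n+1)} Σ_b χ(b) ζ^{-b}` (II.4.8 (19)) is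
`2^{-(n+1)} χ(−1)` times the tree's `Σ_b χ(b) ζ^{b}`; so `τ(χ) · Σ_γ χ⁻¹(γ) ℓ(γ)` and the tree's
`2^{-(n+1)} g(χ,ζ) Σ_j χ⁻¹(−j) V(j)` agree on the nose (the two `χ(−1)` cancel, §3).
(Mathlib's `mul_gaussSum_inv_eq_gaussSum` assumes `[Field R]`; `ℤ/4`, `ℤ/8` are not fields, so the
commutative-ring version is the one needed here; same two-line proof idea.) -/
theorem gaussSum_inv_eq (χ : MulChar R R') (ψ : AddChar R R') :
    gaussSum χ ψ⁻¹ = χ (-1) * gaussSum χ ψ := by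
  rw [gaussSum, gaussSum, Finset.mul_sum]
  refine Fintype.sum_equiv (Equiv.neg R) _ _ fun a ↦ ?_
  rw [Equiv.neg_apply, AddChar.inv_apply, ← mul_assoc, ← map_mul, neg_one_mul, neg_neg]

end GaussSeam

/-! ### §3. The (22) re-indexing `j ↔ γ` and the abstract composition of the atom (Mathlib only) -/

section Reindex

variable {R' : Type*} [CommRing R'] {N : ℕ} [NeZero N]

/-- A sum over a finite monoid of a function vanishing off the units is a sum over the units. -/
theorem sum_eq_sum_units_of_eq_zero {Mo : Type*} [Monoid Mo] [Fintype Mo] [Fintype Moˣ] [DecidableEq Mo]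
    {A : Type*} [AddCommMonoid A] (F : Mo → A) (hF : ∀ m, ¬IsUnit m → F m = 0) :
    ∑ m, F m = ∑ u : Moˣ, F (u : Mo) := by
  have h1 : ∑ u : Moˣ, F (u : Mo) = ∑ x ∈ (Finset.univ : Finset Moˣ).map ⟨Units.val, fun _ _ h ↦ Units.ext h⟩, F x := by
    rw [Finset.sum_map]
    rfl
  rw [h1]
  refine (Finset.sum_subset (Finset.subset_univ _) fun x _ hx ↦ hF x fun hxu ↦ hx ?_).symm
  exact Finset.mem_map.mpr ⟨hxu.unit, Finset.mem_univ _, hxu.unit_spec⟩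

/-- ★ **(22) re-indexing.** `Σ_{j mod N} χ(−j) V(j) = χ(−1) Σ_γ χ(e γ) ℓ(γ)` whenever the torsion-value table
`V` restricted to units is the unit-log table `ℓ` read through `e = κ mod N : Γ ≃ (ℤ/N)ˣ`
(`Γ = U_0/U_n = Gal(F_n/F)`; `V(e γ) = log̃ g_b(ϑ(ζ^{κ γ} − 1)) = log̃ g_{γ b}(ϑ(ζ − 1))` is II.4.5 (iv)). -/
theorem sum_mulChar_neg_mul_eq_sum_units (χ : MulChar (ZMod N) R') (V : ZMod N → R')
    {Γ : Type*} [Fintype Γ] (e : Γ ≃ (ZMod N)ˣ) (ℓ : Γ → R') (hV : ∀ γ, V (e γ : ZMod N) = ℓ γ) :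
    ∑ j : ZMod N, χ (-j) * V j = χ (-1) * ∑ γ : Γ, χ (e γ : ZMod N) * ℓ γ := by
  calc ∑ j : ZMod N, χ (-j) * V j
      = ∑ u : (ZMod N)ˣ, χ (-(u : ZMod N)) * V u :=
        sum_eq_sum_units_of_eq_zero _ fun j hj ↦ by rw [χ.map_nonunit (mt (IsUnit.neg_iff j).mp hj), zero_mul]
    _ = ∑ γ : Γ, χ (-(e γ : ZMod N)) * V (e γ) := (Fintype.sum_equiv e _ _ fun _ ↦ rfl).symm
    _ = ∑ γ : Γ, χ (-1) * (χ (e γ : ZMod N) * ℓ γ) :=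
        Finset.sum_congr rfl fun γ _ ↦ by rw [← neg_one_mul, map_mul, hV, mul_assoc]
    _ = χ (-1) * ∑ γ : Γ, χ (e γ : ZMod N) * ℓ γ := (Finset.mul_sum _ _ _).symm

/-- **SUB-STUB `RamifiedReading` in the ABSTRACT form consumed below** (the Lubin–Tate discharge is Plan C of the
card): the torsion-value table `V(j) = A_b(ζ^j − 1)` of the bounded primitive `A_b = Ω⁻¹ Θ(log̃ g_b ∘ ϑ)` has the
two-term `(7′)` structure `V = V₁ − V₂ ∘ (mod M)` (`log̃ g = log g − ½ log g∘[π']`, and `ϑ(ζ^{2j} − 1)` depends on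
`j mod 2^n = M`), and on units `V₁ ∘ e = ℓ` is the level-`n+1` unit-log table
(`log g_b(ϑ(ζ^{κγ} − 1)) = log g_{γb}(ω_{n+1}) = log (γ b)_n`: II.4.5 (iv) + Coleman `evalAt_cohPt_colemanSeries`). -/
def RamifiedReading {M : ℕ} (hMN : M ∣ N) (V V₁ : ZMod N → R') (V₂ : ZMod M → R')
    {Γ : Type*} (e : Γ ≃ (ZMod N)ˣ) (ℓ : Γ → R') : Prop :=
  (∀ j : ZMod N, V j = V₁ j - V₂ (ZMod.castHom hMN (ZMod M) j)) ∧ ∀ γ : Γ, V₁ (e γ : ZMod N) = ℓ γ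

/-- ★ **`atom_shape` — the PROVED composition (abstract form of (21)₀ from the Gauss side).**  Given the
ramified reading (two-term structure + unit covariance) and a non-factoring witness for `χ` (i.e. `χ` primitive of
conductor exactly `N`: §1b for the keys), the tree's Gauss-side sum `Σ_j χ⁻¹(−j) V(j)` IS de Shalit's
`χ(−1) · Σ_γ χ⁻¹(e γ) · ℓ(γ)` — the `(7′)`-correction `V₂` contributes NOTHING. -/
theorem atom_shape [IsDomain R'] {M : ℕ} (hMN : M ∣ N) (χ : MulChar (ZMod N) R') (u : (ZMod N)ˣ)
    (hu : ZMod.castHom hMN (ZMod M) (u : ZMod N) = 1) (hχu : χ u ≠ 1)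
    {V V₁ : ZMod N → R'} {V₂ : ZMod M → R'} {Γ : Type*} [Fintype Γ] {e : Γ ≃ (ZMod N)ˣ} {ℓ : Γ → R'}
    (hread : RamifiedReading hMN V V₁ V₂ e ℓ) :
    ∑ j : ZMod N, χ⁻¹ (-j) * V j = χ⁻¹ (-1) * ∑ γ : Γ, χ⁻¹ (e γ : ZMod N) * ℓ γ := by
  obtain ⟨hV, hV₁⟩ := hread
  have hvan : ∑ j : ZMod N, χ⁻¹ (-j) * V₂ (ZMod.castHom hMN (ZMod M) j) = 0 := by
    have h := sum_mulChar_mul_apply_castHom_eq_zero hMN χ⁻¹ u hu (inv_apply_ne_one_of_apply_ne_one χ u hχu) V₂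
    calc ∑ j : ZMod N, χ⁻¹ (-j) * V₂ (ZMod.castHom hMN (ZMod M) j)
        = ∑ j : ZMod N, χ⁻¹ (-1) * (χ⁻¹ j * V₂ (ZMod.castHom hMN (ZMod M) j)) :=
          Finset.sum_congr rfl fun j _ ↦ by rw [← neg_one_mul, map_mul, mul_assoc]
      _ = 0 := by rw [← Finset.mul_sum, h, mul_zero]
  calc ∑ j : ZMod N, χ⁻¹ (-j) * V j
      = ∑ j : ZMod N, (χ⁻¹ (-j) * V₁ j - χ⁻¹ (-j) * V₂ (ZMod.castHom hMN (ZMod M) j)) :=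
        Finset.sum_congr rfl fun j _ ↦ by rw [hV, mul_sub]
    _ = ∑ j : ZMod N, χ⁻¹ (-j) * V₁ j := by rw [Finset.sum_sub_distrib, hvan, sub_zero]
    _ = χ⁻¹ (-1) * ∑ γ : Γ, χ⁻¹ (e γ : ZMod N) * ℓ γ := sum_mulChar_neg_mul_eq_sum_units χ⁻¹ V₁ e ℓ hV₁

end Reindex

/-! ### §4. TREE currency: the RAMIFIED COSET FORMULA along the abstract tower at `p = 2` (PROVED) -/

section RamifiedCoset

open Literature.NumberTheory.EllipticCurves GroupDistribution
open scoped Classical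

variable {𝕜 : Type*} [NormedField 𝕜] [NormedAlgebra ℚ_[2] 𝕜] [IsUltrametricDist 𝕜] [CompleteSpace 𝕜]
variable {G : Type*} [Group G] {𝒰 : SubgroupTower G} [∀ n, (𝒰.U n).Normal] (κ : G →* ℤ_[2]ˣ)
  (hU : ∀ (n : ℕ) (g : G), g ∈ 𝒰.U n ↔ g ∈ 𝒰.U 0 ∧ PadicInt.toZModPow (n + 1) (κ g : ℤ_[2]) = 1)
  (hκ : ∀ (n : ℕ) (w : ℤ_[2]ˣ), PadicInt.toZModPow 1 (w : ℤ_[2]) = 1 →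
    ∃ g ∈ 𝒰.U 0, PadicInt.toZModPow (n + 1) (κ g : ℤ_[2]) = PadicInt.toZModPow (n + 1) (w : ℤ_[2]))
  (ψ : (n : ℕ) → G ⧸ 𝒰.U n → ZMod (2 ^ (n + 1)))
  (hψ : ∀ (n : ℕ) (g : G), g ∈ 𝒰.U 0 → ψ n (𝒰.proj n g) = PadicInt.toZModPow (n + 1) (κ g : ℤ_[2]))
variable {B : Type*} [MulAction G B]

omit [NormedAlgebra ℚ_[2] 𝕜] [CompleteSpace 𝕜] in
/-- LINK 2b: `μ|_{ℤ₂ˣ}` is invisible to a multiplicative character of `ℤ/2^{n+1}` (which kills non-units). -/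
theorem integral_restrictUnits_mulChar (ν : BoundedDistribution (ProfiniteTower.padicInt 2) 𝕜) (n : ℕ)
    (χ₀ : MulChar (ZMod (2 ^ (n + 1))) 𝕜) :
    (restrictUnits ν).integral (fun x : ℤ_[2] ↦ χ₀ (PadicInt.toZModPow (n + 1) x)) =
      ν.integral (fun x : ℤ_[2] ↦ χ₀ (PadicInt.toZModPow (n + 1) x)) := by
  have h1 : (restrictUnits ν).integral (fun x : ℤ_[2] ↦ χ₀ (PadicInt.toZModPow (n + 1) x)) =
      ∑ b : ZMod (2 ^ (n + 1)), (restrictUnits ν).μ n b * χ₀ b :=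
    (restrictUnits ν).integral_eq_sum_of_factorsThrough (m := n) (fun b : ZMod (2 ^ (n + 1)) ↦ χ₀ b)
      (fun _ ↦ rfl)
  rw [h1, ν.integral_mulChar_eq_sum n χ₀]
  refine Finset.sum_congr rfl fun b _ ↦ ?_
  rw [restrictUnits_μ]
  split_ifs with hb
  · rfl
  · simp only [χ₀.map_nonunit hb, mul_zero]

omit [NormedAlgebra ℚ_[2] 𝕜] in
/-- ★★ LINKS 1+2 — **ramified coset decomposition along the abstract tower** (the twin of
`integral_induce_character_pow_succ_seriesFamily` for a CHARACTER integrand): for a tower-continuous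
multiplicative `χ : G → 𝕜` whose restriction to `U_0` is `χ₀ ∘ (κ mod 2^{n+1})`,
`∫_G χ d i(b) = Σ_{c ∈ G/U_0} χ(r_c) · ∫_{ℤ₂} χ₀(x mod 2^{n+1}) dν_{r_c⁻¹ • b}(x)`
(de Shalit II.4.8, first line of the proof of (21), with I.3.4 (10)). -/
theorem integral_induce_of_mulChar (ν : B → BoundedDistribution (ProfiniteTower.padicInt 2) 𝕜) {C : ℝ}
    (hC0 : 0 ≤ C)
    (hCb : ∀ b : B, (GroupDistribution.comap (restrictUnits (ν b)) ψ (𝒰.cellMap_trans κ ψ hψ)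
      (𝒰.cellMap_injective κ hU ψ hψ) (𝒰.cellMap_fiberSurj κ hU hκ ψ hψ)).bound ≤ C)
    {n : ℕ} (χ₀ : MulChar (ZMod (2 ^ (n + 1))) 𝕜) {χ : G → 𝕜} (hχc : 𝒰.IsTowerContinuous χ)
    (hχm : ∀ σ τ, χ (σ * τ) = χ σ * χ τ)
    (hχU : ∀ σ ∈ 𝒰.U 0, χ σ = χ₀ (PadicInt.toZModPow (n + 1) (κ σ : ℤ_[2]))) (b : B) :
    (GroupDistribution.induce (fun b ↦ GroupDistribution.comap (restrictUnits (ν b)) ψ (𝒰.cellMap_trans κ ψ hψ)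
        (𝒰.cellMap_injective κ hU ψ hψ) (𝒰.cellMap_fiberSurj κ hU hκ ψ hψ)) hC0 hCb b).integral χ =
      ∑ c ∈ 𝒰.cells 0, χ (𝒰.repr 0 c) *
        (ν ((𝒰.repr 0 c)⁻¹ • b)).integral (fun x : ℤ_[2] ↦ χ₀ (PadicInt.toZModPow (n + 1) x)) := by
  rw [GroupDistribution.integral_induce _ hC0 hCb b hχc]
  refine Finset.sum_congr rfl fun c _ ↦ ?_
  have hg : UniformContinuous fun x : ℤ_[2] ↦ (χ₀ (PadicInt.toZModPow (n + 1) x) : 𝕜) :=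
    uniformContinuous_comp_toZModPow (n + 1) (fun t ↦ (χ₀ t : 𝕜))
  have hfun : ∀ y : G, (if 𝒰.proj 0 y = 1 then (1 : 𝕜) else 0) * χ (𝒰.repr 0 c * y) =
      χ (𝒰.repr 0 c) * ((if 𝒰.proj 0 y = 1 then (1 : 𝕜) else 0) *
        (fun x : ℤ_[2] ↦ (χ₀ (PadicInt.toZModPow (n + 1) x) : 𝕜)) (κ y : ℤ_[2])) := by
    intro y
    by_cases hy : 𝒰.proj 0 y = 1
    · rw [if_pos hy, one_mul, one_mul, hχm, hχU y ((𝒰.proj_zero_eq_one_iff y).mp hy)]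
    · rw [if_neg hy, zero_mul, zero_mul, mul_zero]
  rw [GroupDistribution.integral_congr _ hfun, GroupDistribution.integral_const_mul _ _
      (SubgroupTower.isTowerContinuous_indicator_mul_comp (T := (ProfiniteTower.padicInt 2).succ) ψ
        (Ψ := fun g ↦ (κ g : ℤ_[2])) (𝒰.proj_coe_character_eq_cellMap κ ψ hψ) hg),
    GroupDistribution.integral_comap_restrictUnits_of_character_two κ (ν _) hU hκ ψ hψ hg,
    integral_restrictUnits_mulChar]

/-- ★★★ LINK 3 — **THE RAMIFIED COSET FORMULA** (de Shalit II.4.8 (21) at `k = 0`, β-agnostic, `p = 2`, in the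
LOG-currency family `D_b = comap (D_{P_b}|_{ℤ₂ˣ}) ψ` of bounded series `P_b ∈ 𝕜⟦S⟧`):
`2^{n+1} · ∫_G χ d i(b) = g(χ₀, ζ) · Σ_{c ∈ G/U_0} χ(r_c) · Σ_{j<2^{n+1}} χ₀⁻¹(−j) · P_{r_c⁻¹•b}(ζ^j − 1)`
for `χ₀` PRIMITIVE mod `2^{n+1}` (`n+1 = e ∈ {2,3}` for the six keys) and `ζ` a primitive `2^{n+1}`-th root of `1`.
What remains for the atom: `LogDerivSeam` + `BoundedPrimitive` (to reach this family from the tree's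
derivative-currency `D_b`), `RamifiedReading` (the values `P(ζ^j − 1)`), then `atom_shape` (§3). -/
theorem ramifiedCosetFormula (P : B → PowerSeries 𝕜) {C : ℝ}
    (hC : ∀ (b : B) (m : ℕ), ‖PowerSeries.coeff m (P b)‖ ≤ C) (hC0 : 0 ≤ C)
    (hCb : ∀ b : B, (GroupDistribution.comap (restrictUnits (invAmice₁ 2 (P b) (hC b))) ψ (𝒰.cellMap_trans κ ψ hψ)
      (𝒰.cellMap_injective κ hU ψ hψ) (𝒰.cellMap_fiberSurj κ hU hκ ψ hψ)).bound ≤ C)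
    {n : ℕ} {ζ : 𝕜} (hζ : IsPrimitiveRoot ζ (2 ^ (n + 1))) (χ₀ : DirichletCharacter 𝕜 (2 ^ (n + 1)))
    (hχ₀ : χ₀.IsPrimitive) {χ : G → 𝕜} (hχc : 𝒰.IsTowerContinuous χ) (hχm : ∀ σ τ, χ (σ * τ) = χ σ * χ τ)
    (hχU : ∀ σ ∈ 𝒰.U 0, χ σ = χ₀ (PadicInt.toZModPow (n + 1) (κ σ : ℤ_[2]))) (b : B) :
    ((2 ^ (n + 1) : ℕ) : 𝕜) *
        (GroupDistribution.induce (fun b ↦ GroupDistribution.comap (restrictUnits (invAmice₁ 2 (P b) (hC b))) ψ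
          (𝒰.cellMap_trans κ ψ hψ) (𝒰.cellMap_injective κ hU ψ hψ) (𝒰.cellMap_fiberSurj κ hU hκ ψ hψ))
          hC0 hCb b).integral χ =
      (∑ a : ZMod (2 ^ (n + 1)), χ₀ a * ζ ^ a.val) *
        ∑ c ∈ 𝒰.cells 0, χ (𝒰.repr 0 c) *
          ∑ j ∈ range (2 ^ (n + 1)), χ₀⁻¹ (-(j : ZMod (2 ^ (n + 1)))) *
            ∑' m : ℕ, PowerSeries.coeff m (P ((𝒰.repr 0 c)⁻¹ • b)) * (ζ ^ j - 1) ^ m := by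
  rw [integral_induce_of_mulChar κ hU hκ ψ hψ (fun b ↦ invAmice₁ 2 (P b) (hC b)) hC0 hCb χ₀ hχc hχm hχU b,
    Finset.mul_sum, Finset.mul_sum]
  refine Finset.sum_congr rfl fun c _ ↦ ?_
  have h := mul_integral_mulChar_invAmice₁_eq_gaussSum_mul (hC ((𝒰.repr 0 c)⁻¹ • b)) n hζ χ₀ hχ₀
  linear_combination (χ (𝒰.repr 0 c)) * h

/-! ### §5. The remaining typed sub-stubs (tree currency) -/

/-- **SUB-STUB `LogDerivSeam` (S, tree glue).** The tree's log-free measure `(x⁻¹ · D_{DA})|_{ℤ₂ˣ}` (the family fed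
to `induce` in `PAdicOneVariableSeriesFamilyOfCharacter`, `H = DA`) has the same masses as `D_A|_{ℤ₂ˣ}`.
Route: `density_cast_invAmice₁_μ` (`x · D_A = D_{DA}`) + composition of densities (`x⁻¹ · x = 𝟙_{ℤ₂ˣ}`) + unit
classes consist of units.  No trace hypothesis is needed. -/
def LogDerivSeam (𝕜 : Type*) [NormedField 𝕜] [NormedAlgebra ℚ_[2] 𝕜] [IsUltrametricDist 𝕜] [CompleteSpace 𝕜] :
    Prop :=
  ∀ (A : PowerSeries 𝕜) (C : ℝ) (hC : ∀ m, ‖PowerSeries.coeff m A‖ ≤ C) (n : ℕ) (b : ZMod (2 ^ (n + 1))),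
    (restrictUnits ((invAmice₁ 2 (mahlerD A) (norm_coeff_mahlerD_le hC)).density
        (ProfiniteTower.padicInt_isUniform 2) (unitInv 𝕜) uniformContinuous_unitInv norm_unitInv_le)).μ n b =
      (restrictUnits (invAmice₁ 2 A hC)).μ n b

/-- ★ **`LogDerivSeam` is PROVED** (pure measure algebra over the tree): `x⁻¹ · D_{DA} = x⁻¹ · (x · D_A) =
𝟙_{ℤ₂ˣ} · D_A` (`density_cast_invAmice₁_μ`, `density_density_μ`) and a unit class consists of units. -/
theorem logDerivSeam_holds : LogDerivSeam 𝕜 := by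
  intro A C hC n b
  rw [restrictUnits_μ, restrictUnits_μ]
  split_ifs with hb
  · have hprod : (fun x : ℤ_[2] ↦ unitInv 𝕜 x * padicIntCast 𝕜 x) =
        fun x ↦ if IsUnit (PadicInt.toZModPow 1 x) then (1 : 𝕜) else 0 := by
      funext x
      by_cases hxu : IsUnit x
      · rw [if_pos ((isUnit_toZModPow_one_iff x).mpr hxu)]
        have h := unitInv_mul_padicIntCast_pow_succ (𝕜 := 𝕜) hxu 0
        rwa [zero_add, pow_one, pow_zero, map_one] at h
      · rw [if_neg (mt (isUnit_toZModPow_one_iff x).mp hxu), unitInv_of_not_isUnit hxu, zero_mul]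
    have hfg : UniformContinuous (fun x : ℤ_[2] ↦ unitInv 𝕜 x * padicIntCast 𝕜 x) := by
      rw [hprod]
      exact uniformContinuous_comp_toZModPow 1 (fun t : ZMod (2 ^ 1) ↦ if IsUnit t then (1 : 𝕜) else 0)
    have hfg1 : ∀ x : ℤ_[2], ‖unitInv 𝕜 x * padicIntCast 𝕜 x‖ ≤ 1 := fun x ↦
      (norm_mul_le _ _).trans (mul_le_one₀ (norm_unitInv_le x) (norm_nonneg _) (norm_padicIntCast_le_one x))
    rw [BoundedDistribution.density_μ_congr (D := invAmice₁ 2 (mahlerD A) (norm_coeff_mahlerD_le hC))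
        (D' := (invAmice₁ 2 A hC).density (ProfiniteTower.padicInt_isUniform 2) (fun x ↦ padicIntCast 𝕜 x)
          uniformContinuous_padicIntCast' (fun x ↦ norm_padicIntCast_le_one x))
        (fun m a ↦ (density_cast_invAmice₁_μ hC m a).symm) (ProfiniteTower.padicInt_isUniform 2) (unitInv 𝕜)
        uniformContinuous_unitInv norm_unitInv_le (n + 1) b,
      BoundedDistribution.density_density_μ _ (ProfiniteTower.padicInt_isUniform 2) (unitInv 𝕜)
        (fun x ↦ padicIntCast 𝕜 x) uniformContinuous_unitInv norm_unitInv_le uniformContinuous_padicIntCast'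
        (fun x ↦ norm_padicIntCast_le_one x) hfg hfg1 (n + 1) b,
      BoundedDistribution.density_μ,
      (invAmice₁ 2 A hC).integral_eq_sum_of_factorsThrough (m := n + 1)
        (fun a : ZMod (2 ^ (n + 1)) ↦ if a = b then (1 : 𝕜) else 0) (fun x ↦ ?_)]
    · simp
    · rw [BoundedDistribution.cellFun_apply]
      by_cases hx : (ProfiniteTower.padicInt 2).proj (n + 1) x = b
      · have hxu : IsUnit x := by
          have hx' : PadicInt.toZModPow (n + 1) x = b := hx
          have h1 := hb.map (ZMod.castHom (pow_dvd_pow 2 (show 1 ≤ n + 1 by omega)) (ZMod (2 ^ 1)))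
          rw [ZMod.castHom_apply, ← hx', PadicInt.cast_toZModPow 1 (n + 1) (by omega) x] at h1
          exact (isUnit_toZModPow_one_iff x).mp h1
        have h2 : unitInv 𝕜 x * padicIntCast 𝕜 x = 1 := by
          have h : unitInv 𝕜 x * padicIntCast 𝕜 x = if IsUnit (PadicInt.toZModPow 1 x) then (1 : 𝕜) else 0 :=
            congrFun hprod x
          rw [h, if_pos ((isUnit_toZModPow_one_iff x).mpr hxu)]
        simp [h2]
      · have hx' : ¬ PadicInt.toZModPow (n + 1) x = b := hx
        simp [hx']
  · rfl

/-! ### §5b. SEAM-TRANSPORT (PROVED): integrals of group distributions / induced families see only level data -/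

omit [NormedAlgebra ℚ_[2] 𝕜] [IsUltrametricDist 𝕜] [CompleteSpace 𝕜] [∀ n, (𝒰.U n).Normal] in
/-- `GroupDistribution`-level `integral_congr_μ` (the tree has the `BoundedDistribution` version
`BoundedDistribution.integral_congr_μ`): two group distributions with the same level data have the same
integrals (Riemann sums agree termwise). -/
theorem groupDistribution_integral_congr_μ {D E : GroupDistribution 𝒰 𝕜} (h : ∀ n a, D.μ n a = E.μ n a)
    (f : G → 𝕜) : D.integral f = E.integral f := by
  have hRS : D.riemannSum f = E.riemannSum f := funext fun n ↦ by
    rw [GroupDistribution.riemannSum_def, GroupDistribution.riemannSum_def]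
    exact Finset.sum_congr rfl fun a _ ↦ by rw [h]
  unfold GroupDistribution.integral
  rw [hRS]

omit [NormedAlgebra ℚ_[2] 𝕜] [IsUltrametricDist 𝕜] [CompleteSpace 𝕜] in
/-- ★ **SEAM-TRANSPORT.** Two unit-restricted families on `ℤ₂` with the same masses induce (through the same cell
maps `ψ`) group distributions with the same integrals — `induce_μ` and `comap_μ` are level-data formulas.  So
`logDerivSeam_holds` lets the tree's DERIVATIVE-currency family be replaced by the LOG-currency family of
`ramifiedCosetFormula` inside `induce`, integrand by integrand (next theorem). -/
theorem induce_integral_congr_of_restrictUnits_μ_eq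
    (ν ν' : B → BoundedDistribution (ProfiniteTower.padicInt 2) 𝕜) {C : ℝ} (hC0 : 0 ≤ C)
    (hCb : ∀ b : B, (GroupDistribution.comap (restrictUnits (ν b)) ψ (𝒰.cellMap_trans κ ψ hψ)
      (𝒰.cellMap_injective κ hU ψ hψ) (𝒰.cellMap_fiberSurj κ hU hκ ψ hψ)).bound ≤ C)
    (hCb' : ∀ b : B, (GroupDistribution.comap (restrictUnits (ν' b)) ψ (𝒰.cellMap_trans κ ψ hψ)
      (𝒰.cellMap_injective κ hU ψ hψ) (𝒰.cellMap_fiberSurj κ hU hκ ψ hψ)).bound ≤ C)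
    (h : ∀ (b : B) (n : ℕ) (a : ZMod (2 ^ (n + 1))), (restrictUnits (ν b)).μ n a = (restrictUnits (ν' b)).μ n a)
    (f : G → 𝕜) (b : B) :
    (GroupDistribution.induce (fun b ↦ GroupDistribution.comap (restrictUnits (ν b)) ψ (𝒰.cellMap_trans κ ψ hψ)
        (𝒰.cellMap_injective κ hU ψ hψ) (𝒰.cellMap_fiberSurj κ hU hκ ψ hψ)) hC0 hCb b).integral f =
      (GroupDistribution.induce (fun b ↦ GroupDistribution.comap (restrictUnits (ν' b)) ψ (𝒰.cellMap_trans κ ψ hψ)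
        (𝒰.cellMap_injective κ hU ψ hψ) (𝒰.cellMap_fiberSurj κ hU hκ ψ hψ)) hC0 hCb' b).integral f := by
  refine groupDistribution_integral_congr_μ (fun n a ↦ ?_) f
  simp only [GroupDistribution.induce_μ, GroupDistribution.comap_μ, h]

/-- ★ **THE SEAM IN USE (PROVED).** For a bounded family of primitives `A_b`, the induced measure of the tree's
derivative-currency family `(x⁻¹ · D_{D A_b})|_{ℤ₂ˣ}` (the shape fed to `induce` in
`PAdicOneVariableSeriesFamilyOfCharacter` with `H_b = D A_b`) and the induced measure of the log-currency family
`D_{A_b}|_{ℤ₂ˣ}` of `ramifiedCosetFormula` have the SAME integrals — so `ramifiedCosetFormula` evaluates the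
tree's measure once `BoundedPrimitive` supplies the `A_b`. -/
theorem induce_integral_derivCurrency_eq_logCurrency (A : B → PowerSeries 𝕜) {C : ℝ}
    (hA : ∀ (b : B) (m : ℕ), ‖PowerSeries.coeff m (A b)‖ ≤ C) (hC0 : 0 ≤ C)
    (hCb : ∀ b : B, (GroupDistribution.comap (restrictUnits ((invAmice₁ 2 (mahlerD (A b))
      (norm_coeff_mahlerD_le (hA b))).density (ProfiniteTower.padicInt_isUniform 2) (unitInv 𝕜)
      uniformContinuous_unitInv norm_unitInv_le)) ψ (𝒰.cellMap_trans κ ψ hψ)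
      (𝒰.cellMap_injective κ hU ψ hψ) (𝒰.cellMap_fiberSurj κ hU hκ ψ hψ)).bound ≤ C)
    (hCb' : ∀ b : B, (GroupDistribution.comap (restrictUnits (invAmice₁ 2 (A b) (hA b))) ψ (𝒰.cellMap_trans κ ψ hψ)
      (𝒰.cellMap_injective κ hU ψ hψ) (𝒰.cellMap_fiberSurj κ hU hκ ψ hψ)).bound ≤ C)
    (f : G → 𝕜) (b : B) :
    (GroupDistribution.induce (fun b ↦ GroupDistribution.comap (restrictUnits ((invAmice₁ 2 (mahlerD (A b))
        (norm_coeff_mahlerD_le (hA b))).density (ProfiniteTower.padicInt_isUniform 2) (unitInv 𝕜)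
        uniformContinuous_unitInv norm_unitInv_le)) ψ (𝒰.cellMap_trans κ ψ hψ)
        (𝒰.cellMap_injective κ hU ψ hψ) (𝒰.cellMap_fiberSurj κ hU hκ ψ hψ)) hC0 hCb b).integral f =
      (GroupDistribution.induce (fun b ↦ GroupDistribution.comap (restrictUnits (invAmice₁ 2 (A b) (hA b))) ψ
        (𝒰.cellMap_trans κ ψ hψ) (𝒰.cellMap_injective κ hU ψ hψ) (𝒰.cellMap_fiberSurj κ hU hκ ψ hψ))
        hC0 hCb' b).integral f :=
  induce_integral_congr_of_restrictUnits_μ_eq κ hU hκ ψ hψ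
    (fun b ↦ (invAmice₁ 2 (mahlerD (A b)) (norm_coeff_mahlerD_le (hA b))).density
      (ProfiniteTower.padicInt_isUniform 2) (unitInv 𝕜) uniformContinuous_unitInv norm_unitInv_le)
    (fun b ↦ invAmice₁ 2 (A b) (hA b)) hC0 hCb hCb' (fun b n a ↦ logDerivSeam_holds (A b) C (hA b) n a) f b


/-- **SUB-STUB `BoundedPrimitive` (S/M⁻, analytic).** The derivative-currency series `H_b` of the unit family has a
BOUNDED primitive under `D = (1+S) d/dS`: `A_b = Ω_p⁻¹ · Θ(log̃ g_b ∘ ϑ)` with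
`log̃ g = ½ log (g² / (φg)∘[π'])` INTEGRAL at `p = 2` (`v₂(2^k/k) ≥ 1`; de Shalit I.3.3 (7′), Coates–Wiles).  Typed
β-agnostically: every member of the family has a bounded `D`-primitive with the same bound. -/
def BoundedPrimitive {𝕜 : Type*} [NormedField 𝕜] {B : Type*} (H : B → PowerSeries 𝕜) (C : ℝ) : Prop :=
  ∀ b : B, ∃ A : PowerSeries 𝕜, (∀ m, ‖PowerSeries.coeff m A‖ ≤ C) ∧ mahlerD A = H b

end RamifiedCoset

end Summit.BirchSwinnertonDyer.BirchSwinnertonDyer.Cruxes.SplitBadTwoLowerHalfOfFacts.RamifiedCosetK3G38
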